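/-
Copyright (c) 2026 the pub-hodgecm-mathlib formalisation cell (harness21).  Prover seat hodgecm-mathlib-K2E5-p16 (g9) (S10 dealer R90-C138-plan (g4) DEAL #79 §1 (b1), road (N) of
K2Liu-p26 (g4)'s census `CENSUS-DEAL71-b2-SphericalConstituentOfFrozen.p26-g4.md`, 2026-09-05): R90-TF · S10 (Rogawski 1990 §13.8) · THE DISTINGUISHED VECTORS OF THE `H`-DATUM ARE NON-ZERO.
-/
import Summits.HodgeConjecture.HodgeConjecture.Theorems.R90S10FrozenDatumDefs      -- ★ C2: `S10HDatum` (`V ρ x₀ W σH hx₀ j S₀ hσH hS₀ hfac₂`)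
import Summits.HodgeConjecture.HodgeConjecture.Theorems.F0P3bPrincipalSeriesTrace   -- ★ `nontrivial_of_isConstituentOf`
import Literature.NumberTheory.Automorphic.RestrictedTensorProductIrreducibleProofs  -- ★ the tensor basis road (`Basis.piTensorProduct`)
import HarnessLib

/-!
# R90-TF · S10 (Rogawski 1990 §13.8) · THEOREMS — (b1) `S10HDatum.x₀_ne_zero`: the distinguished vectors `x₀ w` of `ρ = ρ₂ ⊠ θ ≅ ⊗'_w (ρ_w, x₀ w)` are NON-ZERO at every `w ≠ v`

Cell hodgecm-mathlib, slab R90-TF, section S10 = §13.8, crux item h413 = `stmt-HodgeConjecture-24833` (route `route-HodgeConjecture-HCCMUnconditional`).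
Prover seat K2E5-p16 (g9); S10 dealer R90-C138-plan (g4) DEAL #79 §1 (b1) (03:28:19Z (R11)); consumer K2Liu-p26 (g4) DEAL #71 (`hx₀` binder of
`exists_sphericalConstituent_cmPrincipalSeriesH_of_satake`) and K2Liu-p13 (g5) (b3) (`hline ⇒ finrank = 1`).  THEOREMS ONLY (no `def`, no `instance`, no `notation`, no named-fact
hypothesis, no `sorry`); lane `--supports stmt-HodgeConjecture-24833 --as helper`.

THE POINT (K2Liu-p13 (g5)'s census (b1); K2Liu-p26 (g4)'s road (N)).  In ★ `S10HDatum` the line condition `hline : (ρ w)^{K_{H,w}} = ℂ ∙ x₀ w` (`w ≠ v`) does NOT say `x₀ w ≠ 0`;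
that is a consequence of the restricted-tensor structure `hσH : IsRestrictedTensorProductRep ρ σH hx₀ j S₀` with `hS₀ : S₀ ⊆ {v}` and of `hfac₂` (every `V w` carries a constituent,
so `V w ≠ 0`): if `x₀ w = 0` for some `w ∉ S₀`, every family `extend S₀ m` has a ZERO coordinate at `w`, so by restricted multilinearity (`map_update_smul` with `c = 0`) the finite-level
map `liftFinset S₀ : ⨂_{i ∈ S₀} V i → W` vanishes on pure tensors; it is INJECTIVE (★ `IsRestrictedTensorProduct.injective_liftFinset`), so every pure tensor of the non-zero spaces
`V i` (`i ∈ S₀`) would vanish — impossible for the tensor basis (★ Mathlib `Basis.piTensorProduct`).  [Flath1979, §2 Example 2; Bump1997, §3.4.]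

* `liftFinset_tprod_eq_zero_of_apply_eq_zero` — generic: a restricted-multilinear `j` with a base vector `x₀ i = 0` off `S` kills `liftFinset S` on pure tensors;
* `tprod_basis_ne_zero` — generic: a pure tensor of basis vectors is non-zero;
* **`S10HDatum.x₀_ne_zero (𝔥) (w) (hw : w ≠ v) : 𝔥.x₀ w ≠ 0`**.

HONEST LABEL: pays no socket by itself; HC_CM is proved only modulo the 7 printed citations (2 remaining named inputs: hLiu418 = `stmt-HodgeConjecture-24832`, h413 =
`stmt-HodgeConjecture-24833`) until rung 0 closes; count-neutral helper; REL ≠ ★ ≠ BUILT.  Namespace `Summit.HodgeConjecture.HodgeConjecture.R90.S10`.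

## References
* [Flath1979] D. Flath, *Decomposition of representations into tensor products*, PSPM 33.1 (1979), §2 Example 2, Thm. 3.
* [Bump1997] D. Bump, *Automorphic Forms and Representations* (1997), §3.4.
* [Rogawski1990] J. D. Rogawski, *Automorphic Representations of Unitary Groups in Three Variables* (1990), §13.8 p. 218 L9 (ii).
-/

set_option autoImplicit false
-- the mandated namespace repeats the single-problem summit's segment (`HodgeConjecture.HodgeConjecture`)
set_option linter.dupNamespace false

noncomputable section

open scoped RestrictedProduct TensorProduct
open Filter MeasureTheory NumberField IsDedekindDomain PiTensorProduct Module
open Literature.NumberTheory.Rogawski1990 Literature.NumberTheory.Automorphic Literature.NumberTheory.Automorphic.UnitaryGroup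
open Literature.NumberTheory.GaloisRepresentations
open Literature.NumberTheory.Automorphic.Arthur2013.Leaves.TECR
open Summit.HodgeConjecture.HodgeConjecture.Cruxes.H413.K2E1TraceFormulaBeta
open Summit.HodgeConjecture.HodgeConjecture.Cruxes.H413.F0P3bPrincipalSeriesTrace (nontrivial_of_isConstituentOf)

namespace Summit.HodgeConjecture.HodgeConjecture.R90.S10

/-! ## §1 Generic: a zero base vector off `S` kills the finite level `S`; pure tensors of basis vectors are non-zero -/

section Generic

universe u v w

variable {ι : Type u} {V : ι → Type v} [∀ i, AddCommGroup (V i)] [∀ i, Module ℂ (V i)] {x₀ : ∀ i, V i} [DecidableEq ι]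
  {W : Type w} [AddCommGroup W] [Module ℂ W] {j : RestrictedFamily V x₀ → W}

/-- **a zero base vector off `S` kills the finite level `S`**: if `j` is restricted-multilinear and `x₀ i = 0` for some `i ∉ S`, then `liftFinset S (⊗ₗ mₗ) = j (extend S m) = 0`
(the `i`-th coordinate of `extend S m` is `x₀ i = 0 = 0 • 0`). [cite: Flath1979, §2 Example 2] -/
theorem liftFinset_tprod_eq_zero_of_apply_eq_zero (hj : IsRestrictedMultilinear ℂ j) (S : Finset ι) {i : ι} (hi : i ∉ S) (hx : x₀ i = 0)
    (m : ∀ l : S, V l) : hj.liftFinset S (tprod ℂ m) = 0 := by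
  rw [IsRestrictedMultilinear.liftFinset_tprod]
  have h0 : (RestrictedFamily.extend (x₀ := x₀) S m) i = (0 : ℂ) • (0 : V i) := by
    rw [RestrictedFamily.extend_apply_of_notMem S m hi, hx, zero_smul]
  have h1 : RestrictedFamily.extend (x₀ := x₀) S m = (RestrictedFamily.extend (x₀ := x₀) S m).update i ((0 : ℂ) • (0 : V i)) := by
    rw [← h0, RestrictedFamily.update_eq_self]
  rw [h1, hj.map_update_smul, zero_smul]

omit [DecidableEq ι] in
/-- **a pure tensor of basis vectors is non-zero** (it is an element of the tensor basis, Mathlib `Basis.piTensorProduct`). [folklore] -/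
theorem tprod_basis_ne_zero {κ : ι → Type*} [Fintype ι] (b : ∀ i, Basis (κ i) ℂ (V i)) (p : ∀ i, κ i) :
    tprod ℂ (fun i => b i (p i)) ≠ (0 : ⨂[ℂ] i, V i) := by
  classical
  have h := (Basis.piTensorProduct b).ne_zero p
  rwa [Basis.piTensorProduct_apply] at h

end Generic

/-! ## §2 The `H`-datum: `x₀ w ≠ 0` for `w ≠ v` -/

universe u

variable (L : Type) [Field L] [NumberField L] [IsCMField L] [DecidableEq (Pl L)] (μ : HeckeCharacter L) (v : Pl L)
  [MeasurableSpace (HLoc L v)] [BorelSpace (HLoc L v)] [MeasurableSpace (Gqs L v)] [BorelSpace (Gqs L v)]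
  (νHv : Measure (HLoc L v)) (νQv : Measure (Gqs L v)) [νHv.IsHaarMeasure] [νHv.IsMulRightInvariant] [νQv.IsHaarMeasure] [νQv.IsMulRightInvariant]
  [∀ a : HLoc L v, MeasurableSpace (HLoc L v ⧸ Subgroup.centralizer ({a} : Set (HLoc L v)))]
  [∀ a : HLoc L v, BorelSpace (HLoc L v ⧸ Subgroup.centralizer ({a} : Set (HLoc L v)))]
  [∀ γ : Gqs L v, MeasurableSpace (Gqs L v ⧸ Subgroup.centralizer ({γ} : Set (Gqs L v)))]
  [∀ γ : Gqs L v, BorelSpace (Gqs L v ⧸ Subgroup.centralizer ({γ} : Set (Gqs L v)))]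
  (mHv : OrbitalMeasureFamily (HLoc L v)) (mQv : OrbitalMeasureFamily (Gqs L v)) (πSt : IrrClass (HLoc L v))
  [MeasurableSpace (G3 L).Adelic] [BorelSpace (G3 L).Adelic] [MeasurableSpace (H2 L).Adelic] [BorelSpace (H2 L).Adelic]
  [MeasurableSpace (GArch L)] [BorelSpace (GArch L)] [MeasurableSpace (HArch L)] [BorelSpace (HArch L)]
  [MeasurableSpace (H1Loc L v)] [MeasurableSpace (H1Arch L)] [MeasurableSpace (H1 L).Adelic] [BorelSpace (H1 L).Adelic]

omit [MeasurableSpace (G3 L).Adelic] [BorelSpace (G3 L).Adelic] in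
/-- **(b1) THE DISTINGUISHED VECTORS OF THE `H`-DATUM ARE NON-ZERO OFF `v`**: for `𝔥 : S10HDatum` and `w ≠ v`, `𝔥.x₀ w ≠ 0`.  Since `S₀ ⊆ {v}` (`hS₀`), `w ∉ S₀`; if `x₀ w = 0` the
injective finite-level map `liftFinset S₀ : ⨂_{i ∈ S₀} V i → W` of the restricted tensor product `hσH` vanishes on pure tensors (§1), so the tensor basis of the NON-ZERO spaces `V i`
(`i ∈ S₀`; ★ `nontrivial_of_isConstituentOf` at `hfac₂ i`) would vanish — contradiction.  Consumed BY NAME by K2Liu-p26 (g4)'s DEAL #71 and K2Liu-p13 (g5)'s (b3).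
[cite: Flath1979, §2 Example 2; Thm. 3] [cite: Rogawski1990, §13.8 p. 218 L9 (ii)] -/
theorem S10HDatum.x₀_ne_zero (𝔥 : S10HDatum L μ v νHv νQv mHv mQv πSt) (w : Pl L) (hw : w ≠ v) :
    letI := 𝔥.acV w; 𝔥.x₀ w ≠ 0 := by
  classical
  letI := 𝔥.acV; letI := 𝔥.mdV; letI := 𝔥.acW; letI := 𝔥.mdW
  intro hx
  have hwS : w ∉ 𝔥.S₀ := fun h => hw (Finset.mem_singleton.1 (𝔥.hS₀ h))
  -- every `V i`, `i ∈ S₀`, is non-zero (it carries the constituent `ρ₂ i`)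
  haveI hV : ∀ i : ↥𝔥.S₀, Nontrivial (𝔥.V i) := fun i => nontrivial_of_isConstituentOf (𝔥.hfac₂ i)
  -- the tensor basis of `⨂_{i ∈ S₀} V i`
  let b : ∀ i : ↥𝔥.S₀, Basis (Free.ChooseBasisIndex ℂ (𝔥.V i)) ℂ (𝔥.V i) := fun i => Free.chooseBasis ℂ (𝔥.V i)
  haveI : ∀ i : ↥𝔥.S₀, Nonempty (Free.ChooseBasisIndex ℂ (𝔥.V i)) := fun i => (b i).index_nonempty
  obtain ⟨p⟩ : Nonempty (∀ i : ↥𝔥.S₀, Free.ChooseBasisIndex ℂ (𝔥.V i)) := inferInstance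
  -- `liftFinset S₀` kills the basis tensor, but it is injective
  have hinj := 𝔥.hσH.isRestrictedTensorProduct.injective_liftFinset (S := 𝔥.S₀) le_rfl
  have h0 := liftFinset_tprod_eq_zero_of_apply_eq_zero 𝔥.hσH.isRestrictedTensorProduct.isRestrictedMultilinear 𝔥.S₀ hwS hx (fun i => b i (p i))
  rw [← map_zero (𝔥.hσH.isRestrictedTensorProduct.isRestrictedMultilinear.liftFinset 𝔥.S₀)] at h0
  exact tprod_basis_ne_zero b p (hinj h0)

end Summit.HodgeConjecture.HodgeConjecture.R90.S10

end
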